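import Literature.NumberTheory.LFunctions.WeilExplicitRightEdge
import HarnessLib

/-!
# Carathéodory ⟹ unit slack, part III: shifting `∫ F(s) k̂(s)` between vertical lines

Sub-problem `RiemannHypothesis`, route `SignCone`, crux `ConeMagnification` (stmt-RiemannHypothesis-16303),
seat 0.  Support file for `unitSlack_of_cara` (the converse of the landed `stub_cara`).

For a test function `k` (so `|k̂(σ+iy)| ≤ D/(1+y²)²` on strips) and `F` holomorphic on `Re s > a` with
linear growth `‖F(σ+it)‖ ≤ C(1+|t|)` for `σ ∈ [σ₁, σ₂]` (`a < σ₁ ≤ σ₂`), Cauchy's theorem on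
`[σ₁, σ₂] × [−T, T]` and `T → ∞` give
`∫ F(σ₂+iy) k̂(σ₂+iy) dy = ∫ F(σ₁+iy) k̂(σ₁+iy) dy` (`integral_mul_weilMellin_vertical_shift`).
This is the template `integral_digamma_half_mul_weilMellin_shift` of `WeilExplicitRightEdge` with `½ψ(s/2)`
replaced by an abstract `F`.

References: E. Bombieri, Rend. Lincei (9) 11 (2000) §2 (the contour shift in the explicit formula).
-/

noncomputable section

-- `Summit.RiemannHypothesis.RiemannHypothesis.…` repeats a namespace component by design (D-0017 layout).
set_option linter.dupNamespace false

open Complex Filter Set MeasureTheory Literature.NumberTheory.LFunctions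
open scoped Real Topology

namespace Summit.RiemannHypothesis.RiemannHypothesis.Theorems.SignConeConeMagnification

variable {k : ℝ → ℂ}

/-- `(1 + |y|)/(1 + y²)² ≤ 2/(1 + y²)`. [folklore] -/
theorem one_add_abs_div_sq_le (y : ℝ) : (1 + |y|) / (1 + y ^ 2) ^ 2 ≤ 2 * (1 + y ^ 2)⁻¹ := by
  have hy2 : 1 + |y| ≤ 2 * (1 + y ^ 2) := by
    rcases le_or_gt |y| 1 with h | h
    · nlinarith [sq_nonneg y]
    · have : |y| ≤ |y| ^ 2 := by nlinarith
      rw [sq_abs] at this; linarith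
  have hpos : 0 < 1 + y ^ 2 := by positivity
  rw [div_le_iff₀ (by positivity)]
  calc 1 + |y| ≤ 2 * (1 + y ^ 2) := hy2
    _ = 2 * (1 + y ^ 2)⁻¹ * (1 + y ^ 2) ^ 2 := by field_simp

/-- **Integrability on a vertical line against a factor of linear growth**: if `‖F(y)‖ ≤ C(1+|y|)` and
`F` is continuous then `y ↦ F(y) k̂(σ + iy)` is integrable for every test function `k`. [folklore] -/
theorem integrable_mul_weilMellin_vertical_of_norm_le_linear (hk : IsWeilTest k) (σ : ℝ)
    {F : ℝ → ℂ} (hF : Continuous F) {C : ℝ} (hC : ∀ y, ‖F y‖ ≤ C * (1 + |y|)) :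
    Integrable fun y : ℝ => F y * weilMellin k (σ + y * I) := by
  set D := weilDecayW2 |σ - 1 / 2| k with hD
  have hD0 : 0 ≤ D := weilDecayW2_nonneg _ _
  have hC0 : 0 ≤ C := by
    have := (norm_nonneg _).trans (hC 0)
    simpa using this
  refine Integrable.mono' (integrable_inv_one_add_sq.const_mul (2 * C * D))
    (hF.mul (continuous_weilMellin_vertical hk.1.continuous hk.2 σ)).aestronglyMeasurable
    (Eventually.of_forall fun y => ?_)
  have hk' : ‖weilMellin k (σ + y * I)‖ ≤ D / (1 + y ^ 2) ^ 2 := by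
    have := norm_weilMellin_le_sq hk (A := |σ - 1 / 2|) (s := σ + y * I) (by simp)
    simpa [hD] using this
  rw [norm_mul]
  calc ‖F y‖ * ‖weilMellin k (σ + y * I)‖
      ≤ C * (1 + |y|) * (D / (1 + y ^ 2) ^ 2) :=
        mul_le_mul (hC y) hk' (norm_nonneg _) (by positivity)
    _ = C * D * ((1 + |y|) / (1 + y ^ 2) ^ 2) := by ring
    _ ≤ C * D * (2 * (1 + y ^ 2)⁻¹) := by gcongr; exact one_add_abs_div_sq_le y
    _ = 2 * C * D * (1 + y ^ 2)⁻¹ := by ring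

/-- Horizontal sides: for `|T| ≥ 1`, `x ∈ [σ₁, σ₂]`, `‖F(x+iT) k̂(x+iT)‖ ≤ 2 C D / |T|`
(`D = weilDecayW2 A k`, `A = max |σ₁ − 1/2| |σ₂ − 1/2|`). [folklore] -/
theorem norm_mul_weilMellin_horizontal_le (hk : IsWeilTest k) {F : ℂ → ℂ} {σ₁ σ₂ C : ℝ}
    (hC0 : 0 ≤ C) (hC : ∀ σ : ℝ, σ₁ ≤ σ → σ ≤ σ₂ → ∀ t : ℝ, ‖F (σ + t * I)‖ ≤ C * (1 + |t|))
    {T : ℝ} (hT : 1 ≤ |T|) {x : ℝ} (hx : x ∈ Icc σ₁ σ₂) :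
    ‖F (x + T * I) * weilMellin k (x + T * I)‖ ≤
      2 * C * weilDecayW2 (max |σ₁ - 1 / 2| |σ₂ - 1 / 2|) k / |T| := by
  set A := max |σ₁ - 1 / 2| |σ₂ - 1 / 2| with hA
  set D := weilDecayW2 A k with hD
  have hD0 : 0 ≤ D := weilDecayW2_nonneg _ _
  have hxA : |x - 1 / 2| ≤ A := by
    rw [hA, abs_le]
    constructor
    · have := neg_abs_le (σ₁ - 1 / 2)
      have := le_max_left |σ₁ - 1 / 2| |σ₂ - 1 / 2|
      linarith [hx.1]
    · have := le_abs_self (σ₂ - 1 / 2)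
      have := le_max_right |σ₁ - 1 / 2| |σ₂ - 1 / 2|
      linarith [hx.2]
  have hk' : ‖weilMellin k (x + T * I)‖ ≤ D / (1 + T ^ 2) ^ 2 := by
    have := norm_weilMellin_le_sq hk (A := A) (s := x + T * I) (by simpa using hxA)
    simpa [hD] using this
  have hF := hC x hx.1 hx.2 T
  have hT0 : 0 < |T| := by linarith
  rw [norm_mul]
  calc ‖F (x + T * I)‖ * ‖weilMellin k (x + T * I)‖
      ≤ C * (1 + |T|) * (D / (1 + T ^ 2) ^ 2) := mul_le_mul hF hk' (norm_nonneg _) (by positivity)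
    _ = C * D * ((1 + |T|) / (1 + T ^ 2) ^ 2) := by ring
    _ ≤ C * D * (2 / |T|) := by
        refine mul_le_mul_of_nonneg_left ?_ (by positivity)
        rw [div_le_div_iff₀ (by positivity) hT0]
        have h1 : (1 + |T|) * |T| ≤ 2 * T ^ 2 := by rw [← sq_abs]; nlinarith
        have h2 : 2 * T ^ 2 ≤ 2 * (1 + T ^ 2) ^ 2 := by nlinarith [sq_nonneg T]
        linarith
    _ = 2 * C * D / |T| := by ring

/-- The horizontal sides of the shift tend to `0`. [folklore] -/
theorem tendsto_horizontal_mul_weilMellin (hk : IsWeilTest k) {F : ℂ → ℂ} {σ₁ σ₂ C : ℝ}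
    (h12 : σ₁ ≤ σ₂) (hC0 : 0 ≤ C)
    (hC : ∀ σ : ℝ, σ₁ ≤ σ → σ ≤ σ₂ → ∀ t : ℝ, ‖F (σ + t * I)‖ ≤ C * (1 + |t|))
    {e : ℝ} (he : e = 1 ∨ e = -1) :
    Tendsto (fun T : ℝ => ∫ x : ℝ in σ₁..σ₂,
      F (x + (e * T : ℝ) * I) * weilMellin k (x + (e * T : ℝ) * I)) atTop (𝓝 0) := by
  set D := weilDecayW2 (max |σ₁ - 1 / 2| |σ₂ - 1 / 2|) k with hD
  have hD0 : 0 ≤ D := weilDecayW2_nonneg _ _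
  have habs : ∀ T : ℝ, |e * T| = |T| := by
    rcases he with rfl | rfl <;> intro T <;> simp
  rw [tendsto_zero_iff_norm_tendsto_zero]
  refine squeeze_zero' (g := fun T : ℝ => (σ₂ - σ₁) * (2 * C * D) * T⁻¹)
    (Eventually.of_forall fun _ => norm_nonneg _)
    ((eventually_ge_atTop (1 : ℝ)).mono fun T hT => ?_) ?_
  · have hT' : 1 ≤ |e * T| := by rw [habs, abs_of_pos (by linarith)]; exact hT
    have h := intervalIntegral.norm_integral_le_of_norm_le_const (a := σ₁) (b := σ₂)
      (C := 2 * C * D / |e * T|)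
      (f := fun x : ℝ => F (x + (e * T : ℝ) * I) * weilMellin k (x + (e * T : ℝ) * I))
      fun x hx => by
        have hx' : x ∈ Icc σ₁ σ₂ := by
          rw [uIoc_of_le h12] at hx; exact ⟨hx.1.le, hx.2⟩
        exact norm_mul_weilMellin_horizontal_le hk hC0 hC hT' hx'
    refine h.trans (le_of_eq ?_)
    rw [habs, abs_of_pos (by linarith : (0 : ℝ) < T), abs_of_nonneg (by linarith : (0 : ℝ) ≤ σ₂ - σ₁)]
    field_simp
  · have := (tendsto_inv_atTop_zero (𝕜 := ℝ)).const_mul ((σ₂ - σ₁) * (2 * C * D))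
    simpa using this

/-- **Shifting the line of `∫ F(s) k̂(s)`**: for a test function `k`, `F` holomorphic on `Re s > a` with
`‖F(σ+it)‖ ≤ C(1+|t|)` for `σ ∈ [σ₁, σ₂]`, `a < σ₁ ≤ σ₂`:
`∫ F(σ₂+iy) k̂(σ₂+iy) dy = ∫ F(σ₁+iy) k̂(σ₁+iy) dy` (Cauchy's theorem on `[σ₁, σ₂] × [−T, T]`, horizontal
sides `→ 0`). [cite: Bombieri2000Weil, §2] -/
theorem integral_mul_weilMellin_vertical_shift (hk : IsWeilTest k) {F : ℂ → ℂ} {a σ₁ σ₂ C : ℝ}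
    (ha : a < σ₁) (h12 : σ₁ ≤ σ₂) (hFd : DifferentiableOn ℂ F {s : ℂ | a < s.re}) (hC0 : 0 ≤ C)
    (hC : ∀ σ : ℝ, σ₁ ≤ σ → σ ≤ σ₂ → ∀ t : ℝ, ‖F (σ + t * I)‖ ≤ C * (1 + |t|)) :
    ∫ y : ℝ, F (σ₂ + y * I) * weilMellin k (σ₂ + y * I) =
      ∫ y : ℝ, F (σ₁ + y * I) * weilMellin k (σ₁ + y * I) := by
  set Ψ : ℂ → ℂ := fun s => F s * weilMellin k s with hΨ
  have hΨd : DifferentiableOn ℂ Ψ {s : ℂ | a < s.re} :=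
    hFd.mul (differentiable_weilMellin hk.1.continuous hk.2).differentiableOn
  -- Cauchy on `[σ₁, σ₂] × [−T, T]`
  have hrect : ∀ T : ℝ, (∫ x : ℝ in σ₁..σ₂, Ψ (x + (-T : ℝ) * I)) -
      (∫ x : ℝ in σ₁..σ₂, Ψ (x + (T : ℝ) * I)) +
      I * (∫ y : ℝ in (-T)..T, Ψ (σ₂ + y * I)) -
      I * (∫ y : ℝ in (-T)..T, Ψ (σ₁ + y * I)) = 0 := by
    intro T
    have := integral_boundary_rect_eq_zero' Ψ (a := σ₁) (b := σ₂) (c := -T) (d := T)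
      (hΨd.mono fun s hs => by
        have h1 := hs.1
        rw [uIcc_of_le h12] at h1
        simp only [mem_setOf_eq]
        linarith [h1.1])
    simpa using this
  -- limits of the four sides
  have hbot : Tendsto (fun T : ℝ => ∫ x : ℝ in σ₁..σ₂, Ψ (x + (-T : ℝ) * I)) atTop (𝓝 0) := by
    have := tendsto_horizontal_mul_weilMellin hk h12 hC0 hC (e := -1) (Or.inr rfl)
    refine this.congr fun T => ?_
    simp [hΨ]
  have htop : Tendsto (fun T : ℝ => ∫ x : ℝ in σ₁..σ₂, Ψ (x + (T : ℝ) * I)) atTop (𝓝 0) := by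
    have := tendsto_horizontal_mul_weilMellin hk h12 hC0 hC (e := 1) (Or.inl rfl)
    refine this.congr fun T => ?_
    simp [hΨ]
  have hvert : ∀ σ : ℝ, σ₁ ≤ σ → σ ≤ σ₂ → Tendsto (fun T : ℝ => ∫ y : ℝ in (-T)..T, Ψ (σ + y * I)) atTop
      (𝓝 (∫ y : ℝ, Ψ (σ + y * I))) := by
    intro σ h1 h2
    have hcont : Continuous fun y : ℝ => F (σ + y * I) := by
      refine hFd.continuousOn.comp_continuous (by fun_prop) fun y => ?_
      simp only [mem_setOf_eq, add_re, ofReal_re, mul_re, I_re, mul_zero, ofReal_im, I_im, mul_one,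
        sub_self, add_zero]
      linarith
    have hint : Integrable fun y : ℝ => Ψ (σ + y * I) :=
      integrable_mul_weilMellin_vertical_of_norm_le_linear hk σ hcont (hC σ h1 h2)
    exact intervalIntegral_tendsto_integral hint tendsto_neg_atTop_atBot tendsto_id
  have hlim : Tendsto (fun T : ℝ => (∫ x : ℝ in σ₁..σ₂, Ψ (x + (-T : ℝ) * I)) -
      (∫ x : ℝ in σ₁..σ₂, Ψ (x + (T : ℝ) * I)) +
      I * (∫ y : ℝ in (-T)..T, Ψ (σ₂ + y * I)) -
      I * (∫ y : ℝ in (-T)..T, Ψ (σ₁ + y * I))) atTop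
      (𝓝 (0 - 0 + I * (∫ y : ℝ, Ψ (σ₂ + y * I)) - I * (∫ y : ℝ, Ψ (σ₁ + y * I)))) :=
    ((hbot.sub htop).add ((hvert _ h12 le_rfl).const_mul I)).sub ((hvert _ le_rfl h12).const_mul I)
  have h0 : (0 : ℂ) - 0 + I * (∫ y : ℝ, Ψ (σ₂ + y * I)) - I * (∫ y : ℝ, Ψ (σ₁ + y * I)) = 0 :=
    tendsto_nhds_unique hlim (by simp_rw [hrect]; exact tendsto_const_nhds)
  have h1 : I * ((∫ y : ℝ, Ψ (σ₂ + y * I)) - ∫ y : ℝ, Ψ (σ₁ + y * I)) = 0 := by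
    rw [mul_sub]; simpa using h0
  exact sub_eq_zero.1 ((mul_eq_zero.1 h1).resolve_left I_ne_zero)

/-- **Anchor (registered sub-goal `caraShift` of stmt-RiemannHypothesis-16303)**: binder-free restatement of
`integral_mul_weilMellin_vertical_shift`. [folklore] -/
theorem caraShift :
    ∀ k : ℝ → ℂ, IsWeilTest k → ∀ F : ℂ → ℂ, ∀ a σ₁ σ₂ C : ℝ, a < σ₁ → σ₁ ≤ σ₂ →
      DifferentiableOn ℂ F {s : ℂ | a < s.re} → 0 ≤ C →
      (∀ σ : ℝ, σ₁ ≤ σ → σ ≤ σ₂ → ∀ t : ℝ, ‖F (σ + t * Complex.I)‖ ≤ C * (1 + |t|)) →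
      ∫ y : ℝ, F (σ₂ + y * Complex.I) * weilMellin k (σ₂ + y * Complex.I) =
        ∫ y : ℝ, F (σ₁ + y * Complex.I) * weilMellin k (σ₁ + y * Complex.I) :=
  fun _ hk _ _ _ _ _ ha h12 hFd hC0 hC => integral_mul_weilMellin_vertical_shift hk ha h12 hFd hC0 hC

end Summit.RiemannHypothesis.RiemannHypothesis.Theorems.SignConeConeMagnification

end
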